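import Summits.KontsevichZagierPeriods.KontsevichZagierPeriods.Theorems.RootDecompQuadraticDescentPair18HomotopyP07

/-! # `RootDecompQuadraticDescentPair18HomotopyP08` — part 8/31 of the mechanical ≤400-line split of `Pair18Homotopy_v14_noguard.lean` (sha256 72e9c8442b4af820…)
Source: decomp-kz lens-6 g9 `Pair18Homotopy.lean` v14 (HOME/decomp-kz-lens-6/g9/, sha256 3dda3232…; critic g4-48/g4-53/g4-56/g5 CLEARED; census pair #18 of crux stmt-KontsevichZagierPeriods-28994: homotopy cells, duplications, inversions, Euler–Landen, arc/angle regions; terminal `pair18_g8strips_of_grid : hEuler → hGrid → hAng4 → (g8 form of #18)`); `#guard_msgs … #print axioms` pins removed for landing.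
Split by census-1 g9 `gen/splitlean.py`: scopes re-opened with their `open`/`variable`/`set_option` context; mathematics and declaration order unchanged. -/

set_option linter.unusedSimpArgs false
noncomputable section
open _root_.Set MvPolynomial
namespace Summit.KontsevichZagierPeriods.RootDecompQuadraticDescent.Pair18Homotopy
open Literature.NumberTheory.Transcendental
open Literature.NumberTheory.Transcendental.KZ (RFun cube)
open Summit.KontsevichZagierPeriods.RootDecompQuadraticDescent.DarkPairs (rel_reflect_rep rel_double)
/-- Auxiliary step `vec2_1` (§2b): vec2 1. [bookkeeping] -/
private theorem vec2_1 (a b : ℝ) : (![a, b] : Fin 2 → ℝ) 1 = b := rfl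

/-- Auxiliary step `vec2_0` (§2b): vec2 0. [bookkeeping] -/
private theorem vec2_0 (a b : ℝ) : (![a, b] : Fin 2 → ℝ) 0 = a := rfl

/-- Dyadic subdivision of the square along the coordinate `i` (rules 1+2).
[cite: KontsevichZagier2001, §1.2 rules 1, 2] -/
private theorem rel_subdiv (i : Fin 2) (T T₁ T₂ : RFun 2)
    (h₁ : ∀ x ∈ cube 2, T₁.fn x = (1 / 2 : ℝ) * T.fn (Function.update x i (x i / 2)))
    (h₂ : ∀ x ∈ cube 2, T₂.fn x = (1 / 2 : ℝ) * T.fn (Function.update x i ((1 + x i) / 2))) :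
    KZ.of T.rep - KZ.of T₁.rep - KZ.of T₂.rep ∈ KZ.relations :=
  KZ.cubicalSubdivGens_subset_relations ⟨2, T.rep, T₁.rep, T₂.rep, i, rfl, T.analyticOnNhd_fn, rfl,
    T₁.analyticOnNhd_fn, rfl, T₂.analyticOnNhd_fn, h₁, h₂, rfl⟩

/-- Auxiliary step `cube2` (§0): cube2. [bookkeeping] -/
private theorem cube2 {x : Fin 2 → ℝ} (hx : x ∈ KZ.cube 2) : (0 ≤ x 0 ∧ x 0 ≤ 1) ∧ (0 ≤ x 1 ∧ x 1 ≤ 1) := ⟨hx 0, hx 1⟩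

section Inv0

/-- **The Möbius self-map `y ↦ 2y/(1+y)` of the square in the SECOND coordinate** (rule 2). -/
theorem rel_moeb1 (T S : RFun 2)
    (h : ∀ z ∈ cube 2, T.fn z = S.fn ![z 0, 2 * z 1 / (1 + z 1)] * (2 / (1 + z 1) ^ 2)) :
    KZ.of T.rep - KZ.of S.rep ∈ KZ.relations := by
  let Φ : (Fin 2 → ℝ) → (Fin 2 → ℝ) := fun z => ![z 0, 2 * z 1 / (1 + z 1)]
  let Mz : (Fin 2 → ℝ) → Matrix (Fin 2) (Fin 2) ℝ := fun z => !![1, 0; 0, 2 / (1 + z 1) ^ 2]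
  let Φ' : (Fin 2 → ℝ) → (Fin 2 → ℝ) →L[ℝ] (Fin 2 → ℝ) := fun z =>
    LinearMap.toContinuousLinearMap (Matrix.toLin' (Mz z))
  have hΦ'ap : ∀ z w, Φ' z w = ![w 0, 2 / (1 + z 1) ^ 2 * w 1] := by
    intro z w; funext i
    fin_cases i <;> simp [Φ', Mz, Matrix.toLin'_apply, Matrix.mulVec, dotProduct, Fin.sum_univ_two]
  have hdet : ∀ z, (Φ' z).det = 2 / (1 + z 1) ^ 2 := by
    intro z
    unfold ContinuousLinearMap.det
    simp [Φ', LinearMap.det_toLin', Mz, Matrix.det_fin_two]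
  have hdom : S.rep.domain = Φ '' T.rep.domain := by
    rw [RFun.rep_domain, RFun.rep_domain]
    ext w
    constructor
    · intro hw
      have hw0 := (hw 1).1
      have hw1 := (hw 1).2
      have h2 : (0 : ℝ) < 2 - w 1 := by linarith
      refine ⟨![w 0, w 1 / (2 - w 1)], ?_, ?_⟩
      · intro i
        fin_cases i
        · exact hw 0
        · exact ⟨by simpa using div_nonneg hw0 h2.le, by
            simpa using (div_le_one h2).mpr (by linarith)⟩
      · funext i
        fin_cases i
        · simp [Φ]
        · have h3 : (2 : ℝ) - w 1 ≠ 0 := h2.ne'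
          have key : 2 * (w 1 / (2 - w 1)) / (1 + w 1 / (2 - w 1)) = w 1 := by
            field_simp
            ring
          simpa [Φ] using key
    · rintro ⟨z, hz, rfl⟩
      have hz0 := (hz 1).1
      have hz1 := (hz 1).2
      intro i
      fin_cases i
      · simpa [Φ] using hz 0
      · refine ⟨by simpa [Φ] using div_nonneg (by linarith) (by linarith), ?_⟩
        simpa [Φ] using (div_le_one (by linarith)).mpr (by linarith)
  refine KZ.changeOfVariablesRel_subset_relations ⟨2, T.rep, S.rep, Φ, Φ', ?_, ?_, ?_, hdom, ?_, rfl⟩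
  · refine (isSemialgebraicMapOn_iff_forall_holds T.rep.isSemialgebraic_domain).mpr fun i => ?_
    fin_cases i
    · exact (isSemialgebraicFunOn_aeval T.rep.isSemialgebraic_domain (X 0)).congr fun z _ => by
        simp [Φ]
    · exact Mob1.isSemialgebraicFunOn_fn.congr fun z _ => by
        simp [Φ, Mob1, RFun.fn, map_add, map_sub, map_mul, map_pow, map_neg, aeval_C, aeval_X, map_one, map_ofNat,
      eq_ratCast, Rat.cast_one, Rat.cast_ofNat, Rat.cast_div, Rat.cast_neg, Rat.cast_zero]
  · intro z hz
    have hz0 : (0 : ℝ) ≤ z 1 := (hz 1).1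
    have hne : (1 : ℝ) + z 1 ≠ 0 := by positivity
    have hκ : HasDerivAt (fun t : ℝ => 2 * t / (1 + t)) (2 / (1 + z 1) ^ 2) (z 1) := by
      have := (((hasDerivAt_id' (z 1)).const_mul 2).div ((hasDerivAt_id' (z 1)).const_add 1) hne)
      refine this.congr_deriv ?_
      field_simp
      ring
    have h1 : HasFDerivAt (fun w : Fin 2 → ℝ => 2 * w 1 / (1 + w 1))
        ((2 / (1 + z 1) ^ 2) • ContinuousLinearMap.proj (R := ℝ) (φ := fun _ : Fin 2 => ℝ) 1) z :=
      HasDerivAt.comp_hasFDerivAt (𝕜 := ℝ) (h₂ := fun t : ℝ => 2 * t / (1 + t))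
        (f := fun w : Fin 2 → ℝ => w 1) z hκ (hasFDerivAt_apply (𝕜 := ℝ) 1 z)
    have h0 : HasFDerivAt (fun w : Fin 2 → ℝ => w 0)
        (ContinuousLinearMap.proj (R := ℝ) (φ := fun _ : Fin 2 => ℝ) 0) z := hasFDerivAt_apply 0 z
    have hpi : HasFDerivAt Φ (Φ' z) z := by
      rw [hasFDerivAt_pi']
      intro i
      fin_cases i
      · have e : (ContinuousLinearMap.proj (R := ℝ) (φ := fun _ : Fin 2 => ℝ) 0).comp (Φ' z) =
            ContinuousLinearMap.proj (R := ℝ) (φ := fun _ : Fin 2 => ℝ) 0 := by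
          ext w; simp [hΦ'ap]
        simpa [e, Φ] using h0
      · have e : (ContinuousLinearMap.proj (R := ℝ) (φ := fun _ : Fin 2 => ℝ) 1).comp (Φ' z) =
            (2 / (1 + z 1) ^ 2) • ContinuousLinearMap.proj (R := ℝ) (φ := fun _ : Fin 2 => ℝ) 1 := by
          ext w; simp [hΦ'ap]
        simpa [e, Φ, Function.comp_def] using h1
    exact hpi.hasFDerivWithinAt
  · intro z₁ hz₁ z₂ hz₂ heq
    have ha := (hz₁ 1).1
    have hb := (hz₂ 1).1
    have e1 : 2 * z₁ 1 / (1 + z₁ 1) = 2 * z₂ 1 / (1 + z₂ 1) := by simpa [Φ] using congrFun heq 1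
    have e0 : z₁ 0 = z₂ 0 := by simpa [Φ] using congrFun heq 0
    rw [div_eq_div_iff (by positivity) (by positivity)] at e1
    have e1' : z₁ 1 = z₂ 1 := by nlinarith
    funext i
    fin_cases i
    · exact e0
    · exact e1'
  · intro z hz
    have hz0 : (0 : ℝ) ≤ z 1 := (hz 1).1
    rw [hdet, RFun.rep_integrand, RFun.rep_integrand, h z hz, abs_of_nonneg (by positivity)]

/-! ### the reps of §5 -/

/-- Auxiliary definition `Ax0Den`: Ax0 Den. [bookkeeping] -/
def Ax0Den : MvPolynomial (Fin 2) ℚ := C 1 + X 1 * X 0 * X 0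
/-- Auxiliary definition `AhiDen`: Ahi Den. [bookkeeping] -/
def AhiDen : MvPolynomial (Fin 2) ℚ := C 1 + (C 1 + X 1) * X 0 * X 0
/-- Auxiliary definition `BhiDen`: Bhi Den. [bookkeeping] -/
def BhiDen : MvPolynomial (Fin 2) ℚ := C 2 + (C 1 + X 1) * X 0 * X 0
/-- Auxiliary definition `BrefDen`: Bref Den. [bookkeeping] -/
def BrefDen : MvPolynomial (Fin 2) ℚ := C 2 + (C 2 - X 1) * X 0 * X 0
/-- Auxiliary definition `BmDen`: Bm Den. [bookkeeping] -/
def BmDen : MvPolynomial (Fin 2) ℚ := (C 1 + X 1) * (C 1 + X 1 + X 0 * X 0)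
/-- Auxiliary definition `AvDen`: Av Den. [bookkeeping] -/
def AvDen : MvPolynomial (Fin 2) ℚ := C 1 + (C 1 + X 1) * X 0
/-- Auxiliary definition `BvDen`: Bv Den. [bookkeeping] -/
def BvDen : MvPolynomial (Fin 2) ℚ := (C 1 + X 1) * (C 1 + X 1 + X 0)
/-- Auxiliary definition `MstDen`: Mst Den. [bookkeeping] -/
def MstDen : MvPolynomial (Fin 2) ℚ := (C 1 + X 1) * (C 1 + C 2 * X 0)
/-- Auxiliary definition `LhalfDen`: Lhalf Den. [bookkeeping] -/
def LhalfDen : MvPolynomial (Fin 2) ℚ := (C 1 + X 1) * (C 1 + X 0)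
/-- Auxiliary definition `LboxDen`: Lbox Den. [bookkeeping] -/
def LboxDen : MvPolynomial (Fin 2) ℚ := (C 1 + X 0) * (C 1 + X 1)

/-- Auxiliary step `Ax0Den_pos`: Ax0 Den pos. [bookkeeping] -/
theorem Ax0Den_pos {x : Fin 2 → ℝ} (hx : x ∈ KZ.cube 2) : 0 < aeval x Ax0Den := by
  obtain ⟨h0, h1⟩ := cube2 hx
  simp only [map_add, map_sub, map_mul, map_pow, map_neg, aeval_C, aeval_X, map_one, eq_ratCast, Rat.cast_one,
    Rat.cast_ofNat, Rat.cast_div, Rat.cast_neg, Ax0Den]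
  nlinarith [mul_nonneg h1.1 (sq_nonneg (x 0))]
/-- Auxiliary step `AhiDen_pos`: Ahi Den pos. [bookkeeping] -/
theorem AhiDen_pos {x : Fin 2 → ℝ} (hx : x ∈ KZ.cube 2) : 0 < aeval x AhiDen := by
  obtain ⟨h0, h1⟩ := cube2 hx
  simp only [map_add, map_sub, map_mul, map_pow, map_neg, aeval_C, aeval_X, map_one, eq_ratCast, Rat.cast_one,
    Rat.cast_ofNat, Rat.cast_div, Rat.cast_neg, AhiDen]
  nlinarith [mul_nonneg h1.1 (sq_nonneg (x 0)), sq_nonneg (x 0)]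
/-- Auxiliary step `BhiDen_pos`: Bhi Den pos. [bookkeeping] -/
theorem BhiDen_pos {x : Fin 2 → ℝ} (hx : x ∈ KZ.cube 2) : 0 < aeval x BhiDen := by
  obtain ⟨h0, h1⟩ := cube2 hx
  simp only [map_add, map_sub, map_mul, map_pow, map_neg, aeval_C, aeval_X, map_one, eq_ratCast, Rat.cast_one,
    Rat.cast_ofNat, Rat.cast_div, Rat.cast_neg, BhiDen]
  nlinarith [mul_nonneg h1.1 (sq_nonneg (x 0)), sq_nonneg (x 0)]
/-- Auxiliary step `BrefDen_pos`: Bref Den pos. [bookkeeping] -/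
theorem BrefDen_pos {x : Fin 2 → ℝ} (hx : x ∈ KZ.cube 2) : 0 < aeval x BrefDen := by
  obtain ⟨h0, h1⟩ := cube2 hx
  simp only [map_add, map_sub, map_mul, map_pow, map_neg, aeval_C, aeval_X, map_one, eq_ratCast, Rat.cast_one,
    Rat.cast_ofNat, Rat.cast_div, Rat.cast_neg, BrefDen]
  nlinarith [mul_nonneg (sub_nonneg.2 h1.2) (sq_nonneg (x 0)), sq_nonneg (x 0)]
/-- Auxiliary step `BmDen_pos`: Bm Den pos. [bookkeeping] -/
theorem BmDen_pos {x : Fin 2 → ℝ} (hx : x ∈ KZ.cube 2) : 0 < aeval x BmDen := by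
  obtain ⟨h0, h1⟩ := cube2 hx
  simp only [map_add, map_sub, map_mul, map_pow, map_neg, aeval_C, aeval_X, map_one, eq_ratCast, Rat.cast_one,
    Rat.cast_ofNat, Rat.cast_div, Rat.cast_neg, BmDen]
  have : (0:ℝ) < 1 + x 1 := by linarith
  have : (0:ℝ) < 1 + x 1 + x 0 * x 0 := by nlinarith [sq_nonneg (x 0)]
  positivity
/-- Auxiliary step `AvDen_pos`: Av Den pos. [bookkeeping] -/
theorem AvDen_pos {x : Fin 2 → ℝ} (hx : x ∈ KZ.cube 2) : 0 < aeval x AvDen := by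
  obtain ⟨h0, h1⟩ := cube2 hx
  simp only [map_add, map_sub, map_mul, map_pow, map_neg, aeval_C, aeval_X, map_one, eq_ratCast, Rat.cast_one,
    Rat.cast_ofNat, Rat.cast_div, Rat.cast_neg, AvDen]
  nlinarith [mul_nonneg h1.1 h0.1]
/-- Auxiliary step `BvDen_pos`: Bv Den pos. [bookkeeping] -/
theorem BvDen_pos {x : Fin 2 → ℝ} (hx : x ∈ KZ.cube 2) : 0 < aeval x BvDen := by
  obtain ⟨h0, h1⟩ := cube2 hx
  simp only [map_add, map_sub, map_mul, map_pow, map_neg, aeval_C, aeval_X, map_one, eq_ratCast, Rat.cast_one,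
    Rat.cast_ofNat, Rat.cast_div, Rat.cast_neg, BvDen]
  have : (0:ℝ) < 1 + x 1 := by linarith
  have : (0:ℝ) < 1 + x 1 + x 0 := by linarith
  positivity
/-- Auxiliary step `MstDen_pos`: Mst Den pos. [bookkeeping] -/
theorem MstDen_pos {x : Fin 2 → ℝ} (hx : x ∈ KZ.cube 2) : 0 < aeval x MstDen := by
  obtain ⟨h0, h1⟩ := cube2 hx
  simp only [map_add, map_sub, map_mul, map_pow, map_neg, aeval_C, aeval_X, map_one, eq_ratCast, Rat.cast_one,
    Rat.cast_ofNat, Rat.cast_div, Rat.cast_neg, MstDen]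
  have : (0:ℝ) < 1 + x 1 := by linarith
  have : (0:ℝ) < 1 + 2 * x 0 := by linarith
  positivity
/-- Auxiliary step `LhalfDen_pos`: Lhalf Den pos. [bookkeeping] -/
theorem LhalfDen_pos {x : Fin 2 → ℝ} (hx : x ∈ KZ.cube 2) : 0 < aeval x LhalfDen := by
  obtain ⟨h0, h1⟩ := cube2 hx
  simp only [map_add, map_sub, map_mul, map_pow, map_neg, aeval_C, aeval_X, map_one, eq_ratCast, Rat.cast_one,
    Rat.cast_ofNat, Rat.cast_div, Rat.cast_neg, LhalfDen]
  have : (0:ℝ) < 1 + x 1 := by linarith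
  have : (0:ℝ) < 1 + x 0 := by linarith
  positivity
/-- Auxiliary step `LboxDen_pos`: Lbox Den pos. [bookkeeping] -/
theorem LboxDen_pos {x : Fin 2 → ℝ} (hx : x ∈ KZ.cube 2) : 0 < aeval x LboxDen := by
  obtain ⟨h0, h1⟩ := cube2 hx
  simp only [map_add, map_sub, map_mul, map_pow, map_neg, aeval_C, aeval_X, map_one, eq_ratCast, Rat.cast_one,
    Rat.cast_ofNat, Rat.cast_div, Rat.cast_neg, LboxDen]
  have : (0:ℝ) < 1 + x 1 := by linarith
  have : (0:ℝ) < 1 + x 0 := by linarith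
  positivity

/-- `[Ax0] = Θ(0,1) = ∫∫ x/(1+tx²)` -/
def Ax0 : RFun 2 := ⟨X 0, Ax0Den, fun _ hx => (Ax0Den_pos hx).ne'⟩
/-- `2x/(1+tx²)` (the pull-back of `U1` under `x ↦ x²`) -/
def Ax0two : RFun 2 := ⟨C 2 * X 0, Ax0Den, fun _ hx => (Ax0Den_pos hx).ne'⟩
/-- `Θ(0,2) − Θ(0,1)` : `x/(1+(1+t)x²)` -/
def Ahi : RFun 2 := ⟨X 0, AhiDen, fun _ hx => (AhiDen_pos hx).ne'⟩
/-- `Θ(0,1) − Θ(0,½)` : `x/(2+(1+t)x²)` -/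
def Bhi : RFun 2 := ⟨X 0, BhiDen, fun _ hx => (BhiDen_pos hx).ne'⟩
/-- `Bhi` reflected in `t` -/
def Bref : RFun 2 := ⟨X 0, BrefDen, fun _ hx => (BrefDen_pos hx).ne'⟩
/-- `Bhi` after `μ ↦ 1/μ`: `x/((1+t)(1+t+x²))` -/
def Bm : RFun 2 := ⟨X 0, BmDen, fun _ hx => (BmDen_pos hx).ne'⟩
/-- `Ahi` after `x ↦ x²`: `½/(1+(1+t)v)` -/
def Av : RFun 2 := ⟨C (1 / 2), AvDen, fun _ hx => (AvDen_pos hx).ne'⟩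
/-- `Bm` after `x ↦ x²`: `½/((1+t)(1+t+v))` -/
def Bv : RFun 2 := ⟨C (1 / 2), BvDen, fun _ hx => (BvDen_pos hx).ne'⟩
/-- the MASTER form `dw dm/(2mw)` in the coordinates `w = 1 + 2w̃`, `m = 1 + t`: `1/((1+t)(1+2w̃))` -/
def Mst : RFun 2 := ⟨C 1, MstDen, fun _ hx => (MstDen_pos hx).ne'⟩
/-- half the log-square box -/
def Lhalf : RFun 2 := ⟨C (1 / 2), LhalfDen, fun _ hx => (LhalfDen_pos hx).ne'⟩
/-- **the log-square box** `[□², 1/((1+x)(1+y))] = log²2` -/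
def Lbox : RFun 2 := ⟨C 1, LboxDen, fun _ hx => (LboxDen_pos hx).ne'⟩

/-- `[U1] ≡ 2•[Ax0]` (`x ↦ x²`). -/
theorem U1_Ax0 : KZ.of U1.rep - 2 • KZ.of Ax0.rep ∈ KZ.relations := by
  have h1 : KZ.of Ax0two.rep - KZ.of U1.rep ∈ KZ.relations := by
    refine rel_sq Ax0two U1 fun z hz => ?_
    have hz0 := (hz 0).1; have hz1 := (hz 1).1
    have hd : (0:ℝ) < 1 + z 1 * z 0 * z 0 := by nlinarith [mul_nonneg hz1 (sq_nonneg (z 0))]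
    have hd' : (0:ℝ) < 1 + z 0 * z 0 * z 1 := by nlinarith [mul_nonneg hz1 (sq_nonneg (z 0))]
    simp only [Ax0two, U1, Ax0Den, QU1, RFun.fn, map_add, map_sub, map_mul, map_pow, map_neg, aeval_C, aeval_X,
      map_one, map_ofNat, eq_ratCast, Rat.cast_one, Rat.cast_ofNat, Rat.cast_div, Rat.cast_neg, vec2_0, vec2_1,
      Matrix.cons_val_zero, Matrix.cons_val_one, Matrix.head_cons]
    field_simp
    try ring
  have h2 : KZ.of Ax0two.rep - 2 • KZ.of Ax0.rep ∈ KZ.relations := by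
    refine rel_nsmul 2 Ax0two Ax0 fun z hz => ?_
    simp only [Ax0two, Ax0, Ax0Den, RFun.fn, map_add, map_sub, map_mul, map_pow, map_neg, aeval_C, aeval_X,
      map_one, map_ofNat, eq_ratCast, Rat.cast_one, Rat.cast_ofNat, Rat.cast_div, Rat.cast_neg, Nat.cast_ofNat]
    ring
  have e : KZ.of U1.rep - 2 • KZ.of Ax0.rep = (KZ.of Ax0two.rep - 2 • KZ.of Ax0.rep) - (KZ.of Ax0two.rep - KZ.of U1.rep) := by
    abel
  rw [e]; exact sub_mem h2 h1

/-- `[Ax1] ≡ [Ax0] + [Ahi]` (subdivision of the parameter at `½`: `Θ(0,2) = Θ(0,1) + (Θ(0,2) − Θ(0,1))`). -/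
theorem Ax1_split : KZ.of Ax1.rep - KZ.of Ax0.rep - KZ.of Ahi.rep ∈ KZ.relations := by
  refine rel_subdiv 1 Ax1 Ax0 Ahi (fun x hx => ?_) (fun x hx => ?_)
  · obtain ⟨h0, h1⟩ := cube2 hx
    have hd : (0:ℝ) < 1 + x 1 * x 0 * x 0 := by nlinarith [mul_nonneg h1.1 (sq_nonneg (x 0))]
    simp only [Ax1, Ax0, Ax1Den, Ax0Den, RFun.fn, map_add, map_sub, map_mul, map_pow, map_neg, aeval_C, aeval_X,
      map_one, map_ofNat, eq_ratCast, Rat.cast_one, Rat.cast_ofNat, Rat.cast_div, Rat.cast_neg,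
      Function.update_self, Function.update_of_ne (show (0 : Fin 2) ≠ 1 by decide)]
    field_simp
    try ring
  · obtain ⟨h0, h1⟩ := cube2 hx
    have hd : (0:ℝ) < 1 + (1 + x 1) * x 0 * x 0 := by nlinarith [mul_nonneg h1.1 (sq_nonneg (x 0)), sq_nonneg (x 0)]
    simp only [Ax1, Ahi, Ax1Den, AhiDen, RFun.fn, map_add, map_sub, map_mul, map_pow, map_neg, aeval_C, aeval_X,
      map_one, map_ofNat, eq_ratCast, Rat.cast_one, Rat.cast_ofNat, Rat.cast_div, Rat.cast_neg,
      Function.update_self, Function.update_of_ne (show (0 : Fin 2) ≠ 1 by decide)]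
    field_simp
    try ring

/-- `[Ax0] ≡ [E0] + [Bhi]` (`Θ(0,1) = Θ(0,½) + (Θ(0,1) − Θ(0,½))`). -/
theorem Ax0_split : KZ.of Ax0.rep - KZ.of E0.rep - KZ.of Bhi.rep ∈ KZ.relations := by
  refine rel_subdiv 1 Ax0 E0 Bhi (fun x hx => ?_) (fun x hx => ?_)
  · obtain ⟨h0, h1⟩ := cube2 hx
    have hd : (0:ℝ) < 2 + x 1 * x 0 * x 0 := by nlinarith [mul_nonneg h1.1 (sq_nonneg (x 0))]
    simp only [Ax0, E0, Ax0Den, E0Den, RFun.fn, map_add, map_sub, map_mul, map_pow, map_neg, aeval_C, aeval_X,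
      map_one, map_ofNat, eq_ratCast, Rat.cast_one, Rat.cast_ofNat, Rat.cast_div, Rat.cast_neg,
      Function.update_self, Function.update_of_ne (show (0 : Fin 2) ≠ 1 by decide)]
    field_simp
    try ring
  · obtain ⟨h0, h1⟩ := cube2 hx
    have hd : (0:ℝ) < 2 + (1 + x 1) * x 0 * x 0 := by nlinarith [mul_nonneg h1.1 (sq_nonneg (x 0)), sq_nonneg (x 0)]
    simp only [Ax0, Bhi, Ax0Den, BhiDen, RFun.fn, map_add, map_sub, map_mul, map_pow, map_neg, aeval_C, aeval_X,
      map_one, map_ofNat, eq_ratCast, Rat.cast_one, Rat.cast_ofNat, Rat.cast_div, Rat.cast_neg,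
      Function.update_self, Function.update_of_ne (show (0 : Fin 2) ≠ 1 by decide)]
    field_simp
    try ring

/-- `[Bref] ≡ [Bhi]` (reflection of the parameter). -/
theorem Bref_rel : KZ.of Bref.rep - KZ.of Bhi.rep ∈ KZ.relations := by
  refine rel_reflect 1 Bhi Bref fun x hx => ?_
  simp only [Bref, Bhi, BrefDen, BhiDen, RFun.fn, map_add, map_sub, map_mul, map_pow, map_neg, aeval_C, aeval_X,
    map_one, map_ofNat, eq_ratCast, Rat.cast_one, Rat.cast_ofNat, Rat.cast_div, Rat.cast_neg,
    Function.update_self, Function.update_of_ne (show (0 : Fin 2) ≠ 1 by decide)]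
  ring_nf

/-- `[Bm] ≡ [Bref]` (Möbius in the parameter: together with `Bref_rel` this is `μ ↦ 1/μ` on `Θ(0,1) − Θ(0,½)`). -/
theorem Bm_rel : KZ.of Bm.rep - KZ.of Bref.rep ∈ KZ.relations := by
  refine rel_moeb1 Bm Bref fun z hz => ?_
  have hz0 := (hz 0).1; have hz1 := (hz 1).1
  have hne : (1:ℝ) + z 1 ≠ 0 := by positivity
  have hd1 : (0:ℝ) < 1 + z 1 + z 0 * z 0 := by nlinarith [sq_nonneg (z 0)]
  have hd2 : (1:ℝ) + z 0 ^ 2 + z 1 ≠ 0 := by nlinarith [sq_nonneg (z 0)]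
  have hd3 : (2:ℝ) * (1 + z 1) + 2 * z 0 ^ 2 ≠ 0 := by nlinarith [sq_nonneg (z 0)]
  simp only [Bm, Bref, BmDen, BrefDen, RFun.fn, map_add, map_sub, map_mul, map_pow, map_neg, aeval_C, aeval_X,
    map_one, map_ofNat, eq_ratCast, Rat.cast_one, Rat.cast_ofNat, Rat.cast_div, Rat.cast_neg, vec2_0, vec2_1,
    Matrix.cons_val_zero, Matrix.cons_val_one, Matrix.head_cons]
  have e1 : (2 : ℝ) + (2 - 2 * z 1 / (1 + z 1)) * z 0 * z 0 = 2 * (1 + z 1 + z 0 * z 0) / (1 + z 1) := by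
    field_simp
    ring
  have hd1' := hd1.ne'
  rw [e1]
  field_simp

/-- `[Ahi] ≡ [Av]` (`x ↦ x²`). -/
theorem Ahi_sq : KZ.of Ahi.rep - KZ.of Av.rep ∈ KZ.relations := by
  refine rel_sq Ahi Av fun z hz => ?_
  have hz0 := (hz 0).1; have hz1 := (hz 1).1
  have hd : (0:ℝ) < 1 + (1 + z 1) * (z 0 * z 0) := by nlinarith [sq_nonneg (z 0), mul_nonneg hz1 (sq_nonneg (z 0))]
  simp only [Ahi, Av, AhiDen, AvDen, RFun.fn, map_add, map_sub, map_mul, map_pow, map_neg, aeval_C, aeval_X,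
    map_one, map_ofNat, eq_ratCast, Rat.cast_one, Rat.cast_ofNat, Rat.cast_div, Rat.cast_neg, vec2_0, vec2_1,
    Matrix.cons_val_zero, Matrix.cons_val_one, Matrix.head_cons]
  field_simp
  try ring

/-- `[Bm] ≡ [Bv]` (`x ↦ x²`). -/
theorem Bm_sq : KZ.of Bm.rep - KZ.of Bv.rep ∈ KZ.relations := by
  refine rel_sq Bm Bv fun z hz => ?_
  have hz0 := (hz 0).1; have hz1 := (hz 1).1
  have hne : (0:ℝ) < 1 + z 1 := by linarith
  have hd : (0:ℝ) < 1 + z 1 + z 0 * z 0 := by nlinarith [sq_nonneg (z 0)]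
  simp only [Bm, Bv, BmDen, BvDen, RFun.fn, map_add, map_sub, map_mul, map_pow, map_neg, aeval_C, aeval_X,
    map_one, map_ofNat, eq_ratCast, Rat.cast_one, Rat.cast_ofNat, Rat.cast_div, Rat.cast_neg, vec2_0, vec2_1,
    Matrix.cons_val_zero, Matrix.cons_val_one, Matrix.head_cons]
  field_simp
  try ring

/-! ### the master square and its polygonal pieces (`w̃ = X 0`, `t = X 1`; `w = 1 + 2w̃`, `m = 1 + t`) -/

end Inv0
end Summit.KontsevichZagierPeriods.RootDecompQuadraticDescent.Pair18Homotopy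
end
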